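import Literature.Geometry.Symplectic.OrigamiMoserFieldLocal
import Literature.Geometry.Symplectic.OrigamiMoserCalculus
import HarnessLib

/-!
# The origami Moser argument, VII: the chart representatives of the segment and of the primitive

Seventh file of the proof of the named fact `Literature.Geometry.Symplectic.exists_origamiCollarNormalForm`
(Cannas da Silva–Guillemin–Woodward 2000, Thm. 1).  For Moser data `D` on the collar `N × ℝ`,
the representatives in the product chart at `x₁` of the segment and of the primitive,
`repA x₁ (s, q) = Ω̂_s(q)` and `repM x₁ (s, q) = μ̂(q)`, as functions on `ℝ × (ℝ³ × ℝ)` (the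
shape consumed by `hasDerivAt_trackPairing₂` of `OrigamiMoserCalculus.lean`): smoothness,
partial derivatives, **`∂_s A = dμ̂`** (`repA_dot`, from `σ = dμ`, `inChart_mextDeriv_of_mem_target`
and Mathlib's `extDeriv_apply`) and **`dA = 0`** (`repA_closed`, closedness of `Ω_s`).

Everything here is proved; the definitions are explicit; no facts.

## References

* A. Cannas da Silva, V. Guillemin, C. Woodward, *On the unfolding of folded symplectic
  structures*, Math. Res. Lett. 7 (2000), proof of Thm. 1. [CannasGuilleminWoodward2000]
* D. McDuff, D. Salamon, *Introduction to Symplectic Topology*, 3rd ed. (2017), §3.2.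
  [McDuffSalamon2017]
-/

noncomputable section

open scoped Manifold ContDiff Topology Bundle
open Set Function Filter
open Literature.Geometry.Kaehler Literature.Geometry.Manifold Literature.Topology.FourManifolds

namespace Literature.Geometry.Symplectic

namespace OrigamiMoser

local notation "E3" => EuclideanSpace ℝ (Fin 3)
local notation "F4" => EuclideanSpace ℝ (Fin 3) × ℝ
local notation "I34" => ModelWithCorners.prod (𝓡 3) 𝓘(ℝ, ℝ)

/-! ### Vector bookkeeping -/

/-- `g ∘ ![x, y] = ![g x, g y]`. [folklore] -/
theorem comp_vec2' {α β : Type*} (g : α → β) (x y : α) : g ∘ (![x, y] : Fin 2 → α) = ![g x, g y] := by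
  funext i; fin_cases i <;> rfl

/-- `g ∘ ![x] = ![g x]`. [folklore] -/
theorem comp_vec1' {α β : Type*} (g : α → β) (x : α) : g ∘ (![x] : Fin 1 → α) = ![g x] := by
  funext i; fin_cases i; rfl

namespace MoserData

variable {N : Type*} [TopologicalSpace N] [ChartedSpace (EuclideanSpace ℝ (Fin 3)) N]
  [IsManifold (𝓡 3) ∞ N] (D : MoserData N)

/-! ### The chart representatives and their identities -/

/-- The representative of the segment: `A (s, q) = Ω̂_s(q)` in the chart at `x₁`. [folklore] -/
def repA (x₁ : N × ℝ) (y : ℝ × F4) : F4 [⋀^Fin 2]→L[ℝ] ℝ := (D.Ωs y.1).inChart x₁ y.2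

/-- The representative of `μ` (time-independent): `Mu (s, q) = μ̂(q)`. [folklore] -/
def repM (x₁ : N × ℝ) (y : ℝ × F4) : F4 [⋀^Fin 1]→L[ℝ] ℝ := D.μ.inChart x₁ y.2

omit [IsManifold (𝓡 3) ∞ N] in
/-- `A` is affine in `s`: `A (s, q) = Ω̂₀(q) + s • σ̂(q)`. [folklore] -/
theorem repA_eq (x₁ : N × ℝ) (y : ℝ × F4) :
    D.repA x₁ y = D.Ω₀.inChart x₁ y.2 + y.1 • D.σ.inChart x₁ y.2 := D.inChart_Ωs y.1 x₁ y.2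

/-- `A` is `C^∞` on `ℝ × (chart target)`. [folklore] -/
theorem contDiffAt_repA (x₁ : N × ℝ) {y : ℝ × F4} (hy : y.2 ∈ (extChartAt I34 x₁).target) :
    ContDiffAt ℝ ∞ (D.repA x₁) y := by
  have hopen : IsOpen (extChartAt I34 x₁).target := isOpen_extChartAt_target x₁
  have h0 : ContDiffAt ℝ ∞ (fun y : ℝ × F4 => D.Ω₀.inChart x₁ y.2) y :=
    ((D.smooth_Ω₀.contDiffOn_inChart x₁).contDiffAt (hopen.mem_nhds hy)).comp y contDiffAt_snd
  have h1 : ContDiffAt ℝ ∞ (fun y : ℝ × F4 => D.σ.inChart x₁ y.2) y :=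
    ((D.smooth_σ.contDiffOn_inChart x₁).contDiffAt (hopen.mem_nhds hy)).comp y contDiffAt_snd
  have heq : D.repA x₁ = fun y => D.Ω₀.inChart x₁ y.2 + y.1 • D.σ.inChart x₁ y.2 := by
    funext y; exact D.repA_eq x₁ y
  rw [heq]
  exact h0.add (contDiffAt_fst.smul h1)

/-- `Mu` is `C^∞` on `ℝ × (chart target)`. [folklore] -/
theorem contDiffAt_repM (x₁ : N × ℝ) {y : ℝ × F4} (hy : y.2 ∈ (extChartAt I34 x₁).target) :
    ContDiffAt ℝ ∞ (D.repM x₁) y :=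
  ((D.smooth_μ.contDiffOn_inChart x₁).contDiffAt ((isOpen_extChartAt_target x₁).mem_nhds hy)).comp y
    contDiffAt_snd

/-- The `s`-derivative of `A` is `σ̂`. [folklore] -/
theorem fderiv_repA_one_zero (x₁ : N × ℝ) {y : ℝ × F4} (hy : y.2 ∈ (extChartAt I34 x₁).target) :
    fderiv ℝ (D.repA x₁) y (1, 0) = D.σ.inChart x₁ y.2 := by
  obtain ⟨s, q⟩ := y
  have hd : HasFDerivAt (D.repA x₁) (fderiv ℝ (D.repA x₁) (s, q)) (s, q) :=
    ((D.contDiffAt_repA x₁ hy).differentiableAt (by simp)).hasFDerivAt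
  have hc : HasDerivAt (fun s' : ℝ => ((s', q) : ℝ × F4)) ((1 : ℝ), (0 : F4)) s :=
    (hasDerivAt_id s).prodMk (hasDerivAt_const s q)
  have h1 := hd.comp_hasDerivAt s hc
  have h2 : HasDerivAt (fun s' : ℝ => D.repA x₁ (s', q)) (D.σ.inChart x₁ q) s := by
    have : (fun s' : ℝ => D.repA x₁ (s', q)) = fun s' => D.Ω₀.inChart x₁ q + s' • D.σ.inChart x₁ q := by
      funext s'; exact D.repA_eq x₁ (s', q)
    rw [this]
    simpa using ((hasDerivAt_id s).smul_const (D.σ.inChart x₁ q)).const_add (D.Ω₀.inChart x₁ q)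
  exact h1.unique h2

/-- Partial derivatives of `A` in `q` are derivatives of the slice. [folklore] -/
theorem fderiv_repA_zero (x₁ : N × ℝ) {y : ℝ × F4} (hy : y.2 ∈ (extChartAt I34 x₁).target) (a : F4) :
    fderiv ℝ (D.repA x₁) y (0, a) = fderiv ℝ ((D.Ωs y.1).inChart x₁) y.2 a := by
  obtain ⟨s, q⟩ := y
  have hd : DifferentiableAt ℝ (D.repA x₁) (s, q) := (D.contDiffAt_repA x₁ hy).differentiableAt (by simp)
  have hcomp : HasFDerivAt (fun q' => D.repA x₁ (s, q'))
      ((fderiv ℝ (D.repA x₁) (s, q)).comp (ContinuousLinearMap.inr ℝ ℝ F4)) q :=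
    hd.hasFDerivAt.comp q (hasFDerivAt_prodMk_right s q)
  have : (fun q' => D.repA x₁ (s, q')) = (D.Ωs s).inChart x₁ := rfl
  rw [this] at hcomp
  rw [hcomp.fderiv]
  rfl

/-- Partial derivatives of `Mu` in `q`. [folklore] -/
theorem fderiv_repM_zero (x₁ : N × ℝ) {y : ℝ × F4} (hy : y.2 ∈ (extChartAt I34 x₁).target) (a : F4) :
    fderiv ℝ (D.repM x₁) y (0, a) = fderiv ℝ (D.μ.inChart x₁) y.2 a := by
  obtain ⟨s, q⟩ := y
  have hd : DifferentiableAt ℝ (D.repM x₁) (s, q) := (D.contDiffAt_repM x₁ hy).differentiableAt (by simp)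
  have hcomp : HasFDerivAt (fun q' => D.repM x₁ (s, q'))
      ((fderiv ℝ (D.repM x₁) (s, q)).comp (ContinuousLinearMap.inr ℝ ℝ F4)) q :=
    hd.hasFDerivAt.comp q (hasFDerivAt_prodMk_right s q)
  have : (fun q' => D.repM x₁ (s, q')) = D.μ.inChart x₁ := rfl
  rw [this] at hcomp
  rw [hcomp.fderiv]
  rfl

/-- **`∂_s A = dμ̂`** in the chart: `σ̂(q)(a, b) = (Dμ̂ · a)(b) - (Dμ̂ · b)(a)`. [folklore] -/
theorem repA_dot (x₁ : N × ℝ) {y : ℝ × F4} (hy : y.2 ∈ (extChartAt I34 x₁).target) (a b : F4) :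
    fderiv ℝ (D.repA x₁) y (1, 0) ![a, b] =
      fderiv ℝ (D.repM x₁) y (0, a) ![b] - fderiv ℝ (D.repM x₁) y (0, b) ![a] := by
  rw [D.fderiv_repA_one_zero x₁ hy, D.fderiv_repM_zero x₁ hy, D.fderiv_repM_zero x₁ hy]
  have hsm : D.μ.SmoothAt ((extChartAt I34 x₁).symm y.2) := (isSmoothForm_iff_smoothAt _).1 D.smooth_μ _
  have h1 : D.σ.inChart x₁ y.2 = extDeriv (D.μ.inChart x₁) y.2 := by
    show (mextDeriv D.μ).inChart x₁ y.2 = _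
    rw [inChart_mextDeriv_of_mem_target D.μ hy hsm, ModelWithCorners.range_eq_univ, extDerivWithin_univ]
  have hdiff : DifferentiableAt ℝ (D.μ.inChart x₁) y.2 :=
    ((D.smooth_μ.contDiffOn_inChart x₁).contDiffAt ((isOpen_extChartAt_target x₁).mem_nhds hy)).differentiableAt
      (by simp)
  have hpart : ∀ c x : F4, fderiv ℝ (fun q' => D.μ.inChart x₁ q' ![c]) y.2 x =
      fderiv ℝ (D.μ.inChart x₁) y.2 x ![c] := fun c x =>
    fderiv_continuousAlternatingMap_apply_const_apply hdiff ![c] x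
  have e0 : Fin.removeNth (0 : Fin 2) (![a, b] : Fin 2 → F4) = ![b] := by
    funext i; fin_cases i; rfl
  have e1 : Fin.removeNth (1 : Fin 2) (![a, b] : Fin 2 → F4) = ![a] := by
    funext i; fin_cases i; rfl
  rw [h1, extDeriv_apply hdiff, Fin.sum_univ_two, e0, e1]
  simp only [Fin.val_zero, pow_zero, one_smul, Fin.val_one, pow_one, neg_smul,
    Matrix.cons_val_zero, Matrix.cons_val_one, Matrix.cons_val_fin_one, hpart]
  ring

/-- **`dA = 0`** in the chart (closedness of `Ω_s`). [folklore] -/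
theorem repA_closed (x₁ : N × ℝ) {y : ℝ × F4} (hy : y.2 ∈ (extChartAt I34 x₁).target) (a b c : F4) :
    fderiv ℝ (D.repA x₁) y (0, a) ![b, c] - fderiv ℝ (D.repA x₁) y (0, b) ![a, c] +
      fderiv ℝ (D.repA x₁) y (0, c) ![a, b] = 0 := by
  rw [D.fderiv_repA_zero x₁ hy, D.fderiv_repA_zero x₁ hy, D.fderiv_repA_zero x₁ hy]
  have hsm : (D.Ωs y.1).SmoothAt ((extChartAt I34 x₁).symm y.2) :=
    (isSmoothForm_iff_smoothAt _).1 (D.smooth_Ωs y.1) _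
  have hcl : (mextDeriv (D.Ωs y.1)).inChart x₁ y.2 = 0 := by
    have h0 : mextDeriv (D.Ωs y.1) = 0 := D.closed_Ωs y.1
    rw [h0]; rfl
  have h1 : extDeriv ((D.Ωs y.1).inChart x₁) y.2 = 0 := by
    rw [← hcl, inChart_mextDeriv_of_mem_target _ hy hsm, ModelWithCorners.range_eq_univ, extDerivWithin_univ]
  have hdiff : DifferentiableAt ℝ ((D.Ωs y.1).inChart x₁) y.2 :=
    (((D.smooth_Ωs y.1).contDiffOn_inChart x₁).contDiffAt
      ((isOpen_extChartAt_target x₁).mem_nhds hy)).differentiableAt (by simp)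
  have hpart : ∀ (u : Fin 2 → F4) (x : F4), fderiv ℝ (fun q' => (D.Ωs y.1).inChart x₁ q' u) y.2 x =
      fderiv ℝ ((D.Ωs y.1).inChart x₁) y.2 x u := fun u x =>
    fderiv_continuousAlternatingMap_apply_const_apply hdiff u x
  have e0 : Fin.removeNth (0 : Fin 3) (![a, b, c] : Fin 3 → F4) = ![b, c] := by
    funext i; fin_cases i <;> rfl
  have e1 : Fin.removeNth (1 : Fin 3) (![a, b, c] : Fin 3 → F4) = ![a, c] := by
    funext i; fin_cases i <;> rfl
  have e2 : Fin.removeNth (2 : Fin 3) (![a, b, c] : Fin 3 → F4) = ![a, b] := by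
    funext i; fin_cases i <;> rfl
  have h : extDeriv ((D.Ωs y.1).inChart x₁) y.2 ![a, b, c] = 0 := by rw [h1]; rfl
  rw [extDeriv_apply hdiff, Fin.sum_univ_three, e0, e1, e2] at h
  simp only [Fin.val_zero, pow_zero, one_smul, Fin.val_one, pow_one, neg_smul, Fin.val_two,
    Matrix.cons_val_zero, Matrix.cons_val_one, Matrix.cons_val_two, Matrix.tail_cons,
    Matrix.head_cons, hpart] at h
  -- `h : D_a A [b,c] + -(D_b A [a,c]) + (-1)^2 • D_c A [a,b] = 0`
  norm_num at h
  linarith [h]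

end MoserData

end OrigamiMoser

end Literature.Geometry.Symplectic

end
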